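import Literature.AlgebraicGeometry.Modules.RelativeAffineTestObjects
import Literature.AlgebraicGeometry.Modules.RelativeModuleCechStratumFinite
import Literature.AlgebraicGeometry.Modules.GrothendieckComplexKernelRepr
import HarnessLib

/-!
# RELATIVE EDITION (ring base `R`) — The Grothendieck complex computes `H⁰(P ×_R T', g^*L)` on every affine test object
# (GW II Cor. 23.135 / (23.28.5); Mumford AV §5, Lemmas 1–2 and Cor. 2)

RELATIVE EDITION of ★ `Modules/GrothendieckComplexKernelRepr` (cell `hodgecm-mathlib`, F-DAG hand (h8-E) «engine of the relative
seesaw», file E6; author B-p08 (g12); port map `B-provers/B-p08/g11/PORTMAP-h8-RelativeSeesaw.B-p08g11.md`): the ★ file is typed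
`{K : Type u} [Field K] (P T : SchemeOver K)` and uses the field nowhere (its hypotheses are already the explicit ★ binders
`[IsProper P.hom] [GeometricallyIntegral P.hom] [Flat P.hom] [UniversallyOpen P.hom] [IsNoetherianRing Γ(T.left, ⊤)] [IsLocallyNoetherian T.left]`);
decl for decl the twin of ★ with `K ↦ R` over the relative test objects / strata of `Modules/RelativeAffineTestObjects`,
`Modules/RelativeModuleCechStratumFinite` (namespace `Literature.AlgebraicGeometry.Modules.Relative`; the base-free ★ helpers
`kerBaseChangeCongr`, `coe_kerBaseChangeCongr(_symm)_apply`, `trans₄_apply_symm_helper`, `kerDZeroEquiv`, `kerZeroBaseChangeMap(_bijective)`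
are IMPORTED, not copied): `Relative.cechComplex_d_zero_one_hom` · `iSup_testCover` · **`grothendieckComplex`** · `grothendieckMap` ·
`grothendieckComplex_spec` · `kerZeroGrothendieckEquiv` · **`kernelReprEquiv`** · `coe_kerZeroGrothendieckEquiv_apply` · `cochainBC_kernelReprEquiv`.
Everything is proved; no named facts, no `sorry`.  HC_CM is proved only modulo the 7 printed citations until rung 0 closes; this file
asserts nothing about HC.  Original module docstring (read `K` as `R`):

For `P → Spec K` proper, geometrically integral (flat, universally open), `T` affine with noetherian ring
`A = Γ(T, 𝒪_T)`, a finite cover `𝓥` of `P ×_K T` by affine opens with affine intersections and a line bundle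
`L`, the strictly perfect model `K• → Č•(𝓥, L)` of `Modules/ModuleCechStratumFinite`
(`exists_strictlyPerfect_quasiIso_cechComplex_of_hasRank_one'`) yields the **Grothendieck complex**
`Modules.grothendieckComplex` (finitely generated projective terms in degrees `[0, r]`, quasi-isomorphic to
the module Čech complex: `grothendieckMap`, `grothendieckComplex_spec`) such that for EVERY affine test object
`j : T' → T` (`Modules/AffineTestObjects`; `B' = Γ(T', 𝒪)` an `A`-algebra through `j♯`) there is a
`B'`-linear isomorphism
  `θ_{T'} : Γ(P ×_K T', g^*L) ≃ₗ[B'] ker(d⁰ of K• ⊗_A B')`  (**`Modules.kernelReprEquiv`**):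
`K• ⊗ B' → Č• ⊗ B'` stays a quasi-isomorphism in degree `0` (★ `Algebra/Homology/KerZeroOfQuasiIsoNatural`:
flat terms, Mumford §5 Lemma 2; `Modules.kerZeroGrothendieckEquiv`), `Č•(𝓥, L) ⊗_A B' ≅ Č•(g⁻¹𝓥, g^*L)`
termwise (`Modules.kerDZeroBaseChangeEquiv`), and `H⁰` of the module Čech complex of `g^*L` is
`Γ(g^*L, ⊤)` (`Modules/ModuleCechHZero`: `kerDZeroEquiv`). The value of `θ` on degree-`0` cochains is
recorded in `Modules.cochainBC_kernelReprEquiv` (used by the naturality file).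

## References
* U. Görtz, T. Wedhorn, *Algebraic Geometry II: Cohomology of Schemes* (2023),
  doi:10.1007/978-3-658-43031-3: Cor. 23.135 (p. 355), Cor. 23.137, (23.28.5). [GortzWedhorn2023]
* D. Mumford, *Abelian Varieties*, TIFR Studies in Mathematics 5 (1970), §5, Lemmas 1–2, Cor. 2
  (pp. 46–50). [MumfordAV1970]
* A. Grothendieck, EGA III₂ (Publ. Math. IHÉS 17, 1963), (6.10.5), (7.7.6). [EGA3]
-/

set_option autoImplicit false

universe u

open CategoryTheory CategoryTheory.Limits AlgebraicGeometry TopologicalSpace Opposite MonoidalCategory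
open CartesianMonoidalCategory TensorProduct
open Literature.AlgebraicGeometry.Motives Literature.Algebra.Homology

set_option backward.isDefEq.respectTransparency false

noncomputable section

namespace Literature.AlgebraicGeometry.Modules

namespace Relative

/-! ### §3 The Grothendieck complex of `L` and the kernel representation on affine test objects -/

section Kernel

variable {R : Type u} [CommRing R] (P T : SchemeOver R) [IsAffine T.left]
variable {ι : Type} [LinearOrder ι] [Fintype ι] (𝓥 : ι → (P ⊗ T).left.Opens) (L : (P ⊗ T).left.Modules)
variable (hV : ∀ s : Finset ι, s.Nonempty → IsAffineOpen (cechOpen 𝓥 s)) (hcov : ⨆ i, 𝓥 i = ⊤)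

omit [IsAffine T.left] [Fintype ι] in
/-- The first differential of the module Čech complex is `d⁰`. [folklore] [cite: GortzWedhorn2023, Cor. 23.135 (p. 355)] -/
theorem cechComplex_d_zero_one_hom :
    ((cechComplex 𝓥 L (Relative.baseToTotal P T)).d 0 1).hom = OrderedCech.sysD (sectionsSystem 𝓥 L (Relative.baseToTotal P T)) 0 := by
  have := OrderedCech.sysComplex_d (sectionsSystem 𝓥 L (Relative.baseToTotal P T)) 0
  exact congrArg ModuleCat.Hom.hom this

include hcov in
omit [IsAffine T.left] [LinearOrder ι] [Fintype ι] in
/-- The cover stays covering after base change to `T'`. [folklore] [cite: GortzWedhorn2023, Cor. 23.135 (p. 355)] -/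
theorem iSup_testCover {T' : SchemeOver R} (j : T' ⟶ T) : ⨆ i, Relative.testCover P T j 𝓥 i = ⊤ := by
  change ⨆ i, Relative.testMap P T j ⁻¹ᵁ 𝓥 i = ⊤
  rw [← Scheme.Hom.preimage_iSup, hcov, Scheme.Hom.preimage_top]

variable [IsProper P.hom] [GeometricallyIntegral P.hom] [Flat P.hom] [UniversallyOpen P.hom]
  [IsNoetherianRing Γ(T.left, ⊤)] [IsLocallyNoetherian T.left] (hL : HasRank L 1)

/-- **The Grothendieck complex `K•` of the line bundle `L` on `P ×_R T`** (a choice of the strictly perfect model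
`K• → Č•(𝓥, L)` in degrees `[0, #ι]` of `exists_strictlyPerfect_quasiIso_cechComplex_of_hasRank_one'`).
[cite: GortzWedhorn2023, Cor. 23.135 (p. 355)] -/
def grothendieckComplex : CochainComplex (ModuleCat.{u} (Γ(T.left, ⊤) : CommRingCat.{u})) ℤ :=
  Classical.choose (Relative.exists_strictlyPerfect_quasiIso_cechComplex_of_hasRank_one' P T 𝓥 L hV hcov hL
    (Fintype.card ι) (by omega))

/-- The quasi-isomorphism `K• → Č•(𝓥, L)`. [cite: GortzWedhorn2023, Cor. 23.135 (p. 355)] -/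
def grothendieckMap : Relative.grothendieckComplex P T 𝓥 L hV hcov hL ⟶ cechComplex 𝓥 L (Relative.baseToTotal P T) :=
  Classical.choose (Classical.choose_spec (Relative.exists_strictlyPerfect_quasiIso_cechComplex_of_hasRank_one'
    P T 𝓥 L hV hcov hL (Fintype.card ι) (by omega)))

/-- The defining properties of the Grothendieck complex. [folklore] [cite: GortzWedhorn2023, Cor. 23.135 (p. 355)] -/
theorem grothendieckComplex_spec :
    QuasiIso (Relative.grothendieckMap P T 𝓥 L hV hcov hL) ∧ (Relative.grothendieckComplex P T 𝓥 L hV hcov hL).IsStrictlyGE 0 ∧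
      (Relative.grothendieckComplex P T 𝓥 L hV hcov hL).IsStrictlyLE (Fintype.card ι : ℤ) ∧
      ∀ n, Module.Finite Γ(T.left, ⊤) ((Relative.grothendieckComplex P T 𝓥 L hV hcov hL).X n) ∧
        Module.Projective Γ(T.left, ⊤) ((Relative.grothendieckComplex P T 𝓥 L hV hcov hL).X n) :=
  Classical.choose_spec (Classical.choose_spec (Relative.exists_strictlyPerfect_quasiIso_cechComplex_of_hasRank_one'
    P T 𝓥 L hV hcov hL (Fintype.card ι) (by omega)))

variable {T' : SchemeOver R} [IsAffine T'.left] (j : T' ⟶ T)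

/-- Mumford's Lemma 2 for the Grothendieck complex: `ker(d⁰_K ⊗ B') ≃ ker(d⁰_Č ⊗ B')`. [cite: MumfordAV1970, §5, Lemma 2] -/
def kerZeroGrothendieckEquiv :
    letI := Relative.testAlgebra T j
    LinearMap.ker (((Relative.grothendieckComplex P T 𝓥 L hV hcov hL).d 0 1).hom.baseChange Γ(T'.left, ⊤)) ≃ₗ[Γ(T'.left, ⊤)]
      LinearMap.ker (((cechComplex 𝓥 L (Relative.baseToTotal P T)).d 0 1).hom.baseChange Γ(T'.left, ⊤)) := by
  letI := Relative.testAlgebra T j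
  have hsp := Relative.grothendieckComplex_spec P T 𝓥 L hV hcov hL
  haveI := hsp.1
  haveI := hsp.2.1
  haveI := hsp.2.2.1
  haveI : (cechComplex 𝓥 L (Relative.baseToTotal P T)).IsStrictlyGE 0 := isStrictlyGE_cechComplex _ _ _
  haveI : (cechComplex 𝓥 L (Relative.baseToTotal P T)).IsStrictlyLE (Fintype.card ι : ℤ) :=
    isStrictlyLE_cechComplex _ _ _ _ (by omega)
  exact LinearEquiv.ofBijective (kerZeroBaseChangeMap (Relative.grothendieckMap P T 𝓥 L hV hcov hL) Γ(T'.left, ⊤))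
    (kerZeroBaseChangeMap_bijective (Relative.grothendieckMap P T 𝓥 L hV hcov hL) Γ(T'.left, ⊤)
      (fun n => by haveI := (hsp.2.2.2 n).2; exact Module.Flat.of_projective)
      (flat_cechComplex_X 𝓥 L _ (Relative.flat_secMod_baseToTotal P T 𝓥 L hV (HasRank.isFiniteLocallyFree' hL)))
      (Fintype.card ι : ℤ))

/-- **THE KERNEL REPRESENTATION `θ_{T'} : Γ(P ×_R T', g^*L) ≃ₗ[B'] ker(d⁰_K ⊗_A B')`** on an affine test object
`j : T' → T`: the Grothendieck complex computes `H⁰` after every affine base change (Görtz–Wedhorn II,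
Cor. 23.135 with (23.28.5); Mumford §5, Lemmas 1–2). [cite: GortzWedhorn2023, Cor. 23.135 (p. 355) and (23.28.5)] -/
def kernelReprEquiv :
    letI := Relative.testAlgebra T j
    SecMod (Relative.testMod P T j L) (Relative.baseToTotal P T') ⊤ ≃ₗ[Γ(T'.left, ⊤)]
      LinearMap.ker (((Relative.grothendieckComplex P T 𝓥 L hV hcov hL).d 0 1).hom.baseChange Γ(T'.left, ⊤)) :=
  letI := Relative.testAlgebra T j
  (kerDZeroEquiv (Relative.testCover P T j 𝓥) (Relative.testMod P T j L) (Relative.baseToTotal P T') (Relative.iSup_testCover P T 𝓥 hcov j)).trans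
    ((Relative.kerDZeroBaseChangeEquiv P T j 𝓥 L hV (HasRank.isFiniteLocallyFree' hL)).symm.trans
      ((kerBaseChangeCongr (B := Γ(T'.left, ⊤)) (Relative.cechComplex_d_zero_one_hom P T 𝓥 L)).symm.trans
        (Relative.kerZeroGrothendieckEquiv P T 𝓥 L hV hcov hL j).symm))

omit [IsAffine T'.left] in
/-- Underlying element of `kerZeroGrothendieckEquiv v`: `(ψ⁰ ⊗ B') v`. [folklore] [cite: GortzWedhorn2023, Cor. 23.135 (p. 355)] -/
theorem coe_kerZeroGrothendieckEquiv_apply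
    (v : letI := Relative.testAlgebra T j
      LinearMap.ker (((Relative.grothendieckComplex P T 𝓥 L hV hcov hL).d 0 1).hom.baseChange Γ(T'.left, ⊤))) :
    letI := Relative.testAlgebra T j
    ((Relative.kerZeroGrothendieckEquiv P T 𝓥 L hV hcov hL j v : LinearMap.ker _) :
        Γ(T'.left, ⊤) ⊗[Γ(T.left, ⊤)] (cechComplex 𝓥 L (Relative.baseToTotal P T)).X 0) =
      ((Relative.grothendieckMap P T 𝓥 L hV hcov hL).f 0).hom.baseChange Γ(T'.left, ⊤) (v : _) := rfl

/-- **What `θ` does on cochains**: `(Θ ⊗ 1)((ψ⁰ ⊗ B')(θ x)) = (x|_{V'_i})_i` — the defining property of the kernel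
representation (it is the composite of the augmentation with the inverses of the three comparison isomorphisms).
[folklore] [cite: GortzWedhorn2023, Cor. 23.135 (p. 355)] -/
theorem cochainBC_kernelReprEquiv (x : SecMod (Relative.testMod P T j L) (Relative.baseToTotal P T') ⊤) :
    letI := Relative.testAlgebra T j
    Relative.cochainBC P T j 𝓥 L hV (HasRank.isFiniteLocallyFree' hL) 0
        (((Relative.grothendieckMap P T 𝓥 L hV hcov hL).f 0).hom.baseChange Γ(T'.left, ⊤)
          ((Relative.kernelReprEquiv P T 𝓥 L hV hcov hL j x : LinearMap.ker _) : _)) =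
      cechAugment (Relative.testCover P T j 𝓥) (Relative.testMod P T j L) (Relative.baseToTotal P T') x := by
  letI := Relative.testAlgebra T j
  rw [← Relative.coe_kerZeroGrothendieckEquiv_apply]
  have h1 : Relative.kerZeroGrothendieckEquiv P T 𝓥 L hV hcov hL j (Relative.kernelReprEquiv P T 𝓥 L hV hcov hL j x) =
      (kerBaseChangeCongr (B := Γ(T'.left, ⊤)) (Relative.cechComplex_d_zero_one_hom P T 𝓥 L)).symm
        ((Relative.kerDZeroBaseChangeEquiv P T j 𝓥 L hV (HasRank.isFiniteLocallyFree' hL)).symm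
          (kerDZeroEquiv (Relative.testCover P T j 𝓥) (Relative.testMod P T j L) (Relative.baseToTotal P T') (Relative.iSup_testCover P T 𝓥 hcov j) x)) := by
    delta Relative.kernelReprEquiv
    exact trans₄_apply_symm_helper (R := Γ(T'.left, ⊤))
      (kerDZeroEquiv (Relative.testCover P T j 𝓥) (Relative.testMod P T j L) (Relative.baseToTotal P T') (Relative.iSup_testCover P T 𝓥 hcov j))
      (Relative.kerDZeroBaseChangeEquiv P T j 𝓥 L hV (HasRank.isFiniteLocallyFree' hL))
      (kerBaseChangeCongr (B := Γ(T'.left, ⊤)) (Relative.cechComplex_d_zero_one_hom P T 𝓥 L))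
      (Relative.kerZeroGrothendieckEquiv P T 𝓥 L hV hcov hL j) x
  rw [h1, coe_kerBaseChangeCongr_symm_apply]
  exact (Relative.cochainBC_kerDZeroBaseChangeEquiv_symm P T j 𝓥 L hV (HasRank.isFiniteLocallyFree' hL) _).trans
    (coe_kerDZeroEquiv_apply _ _ _ _ x)

end Kernel

end Relative

end Literature.AlgebraicGeometry.Modules

end
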